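import Summits.NavierStokesRegularity.NavierStokesRegularity.Theorems.TypeIIInviscidRelaxationAxisymSwirlRegularZhangBarrierW
import HarnessLib

/-!
# The self-similar reduction: a profile ODE supersolution gives a time-dependent half-line barrier, for ANY
# inflow Reynolds-number profile

Helper toward the crux `AxisymSwirlRegular` (stmt-NavierStokesRegularity-1964, route TypeIIInviscidRelaxation),
criterion side of the registered line `radial_inflow_split` (stub `stub_oneSidedRadialCriterion`, ⟨19059⟩).

The landed comparison engine `RadialInflowComparisonT.hasSmoothExtensionPast_of_timeDependentBarrier_visc` turns a
one-sided gate `u_r ≥ −E(r,t)` on the unit tube into continuation past `T` as soon as a time-dependent half-line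
barrier `w` (clause list `hB`: `C²`, continuous up to the axis, `w(0,s)=0`, monotone, `w ≤ C r^α`, `w(1,s) ≥ 1`,
`w(r,0) ≥ min(r,1)²`, `w_rr − w_r/r + E w_r ≤ w_s`) exists.  The κ-chain (`…RiccatiW` … `…ZhangBarrierW`,
p821280–p821608) built such a barrier for the envelopes `M r^{κ−1}(T−t)^{−κ/2}` by the SELF-SIMILAR ansatz
`w = Λ (S−s)^m F(r/√(S−s))`; this file isolates that ansatz as a generic, reusable reduction:

* `exists_halfLineBarrier_selfSimilar` — for ANY Reynolds-number profile `D` (gate `−r u_r ≤ D(r/√(S−s))`, i.e.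
  drift coefficient `D(ξ)/r`, `ξ = r(S−s)^{−1/2}`) and any profile `F` that is `C²` on `(0,∞)`, continuous and
  monotone on `[0,∞)` with `F(0) = 0`, squeezed as `k₁ξ^{2m} ≤ F ≤ C₀ξ^{2m}` (far) and `F ≥ k₂ξ²` (near), and solves
  the PROFILE INEQUALITY `F″ + (D(ξ)/ξ − 1/ξ − ξ/2)F′ + mF ≤ 0` on `(0,∞)` (`0 < m`, `2m ≤ 1`), the function
  `w(r,s) = Λ e^{m log(S−s)} F(r ρ(s))`, `ρ(s) = e^{−log(S−s)/2}` (`= (S−s)^{−1/2}`, the tree's `ZhangBarrier.rho`),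
  satisfies the whole clause list with `α = 2m` — the ODE is all that is left;
* `hasSmoothExtensionPast_of_reynoldsProfile` — END TO END: such a pair `(D, F)` yields the one-sided criterion
  «inflow Reynolds number `−r u_r/ν ≤ D(r/√(ν(T−t)))` on the unit tube ⇒ continuation past `T`» for every
  axisymmetric classical Leray–Hopf solution of the standing class, every `ν > 0`;
* `exists_halfLineBarrier_selfSimilar_kappa` — consistency: with `D(ξ) = Mξ^κ` and the tree's profile `profW κ M`
  the reduction reproduces the κ-barrier (`ZhangBarrier.exists_halfLineBarrierW`).

Use (repair census R4 of ⟨1964⟩, hand 2-g2): the method frontier mapped by `RadialInflowBarrierWall*` /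
`RadialInflowCriticalSink` says the comparison route reaches exactly the gates whose Bessel scale integral
converges at the axis; the natural sharp criterion of this kind — inflow Reynolds number `< 2` ONLY INSIDE the
parabolic core `r ≲ √(ν(T−t))`, arbitrary power growth outside (`D(0) < 2`, `D(ξ) ≲ ξ^κ`) — is now a pure ODE task
(a profile `F ∼ ξ^{2−D(0)}` at `0`, `∼ ξ^{2m}` at `∞`).  Honest label: infrastructure (a reduction), no new
criterion is claimed here beyond the κ-family; nothing here proves `AxisymSwirlRegular` or NavierStokesRegularity.

References: Qi S. Zhang, arXiv:2604.07785 (2026), §3 [Zhang2026PartialTypeI] (self-similar half-line barrier at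
`κ = 1`). [folklore]
-/

noncomputable section

set_option linter.dupNamespace false

open Set Filter Topology Real
open Literature.Analysis.FluidPDE

namespace Summit.NavierStokesRegularity.NavierStokesRegularity.Theorems.RadialInflowSelfSimilar

open Summit.NavierStokesRegularity.NavierStokesRegularity.Theorems
open Summit.NavierStokesRegularity.NavierStokesRegularity.Theorems.ZhangBarrier
open Summit.NavierStokesRegularity.NavierStokesRegularity.Theorems.ScenarioCensus.LogGate

/-! ## §1 Calculus of the ansatz `w(r,s) = Λ e^{m log(S−s)} F(r ρ(s))` -/

/-- `e^{m log(S−s)} · ρ(s)^{2m} = 1`. -/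
theorem sig_mul_rho_rpow (m S s : ℝ) : exp (m * log (S - s)) * rho S s ^ (2 * m) = 1 := by
  unfold rho
  rw [← exp_mul, ← exp_add, show m * log (S - s) + -(log (S - s) / 2) * (2 * m) = 0 by ring, exp_zero]

/-- Pointwise first and second derivatives of a profile `C²` on `(0,∞)`. -/
theorem profile_derivs {F : ℝ → ℝ} (hFC : ContDiffOn ℝ 2 F (Ioi 0)) {ξ : ℝ} (hξ : 0 < ξ) :
    HasDerivAt F (deriv F ξ) ξ ∧ HasDerivAt (deriv F) (iteratedDeriv 2 F ξ) ξ :=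
  SliceCalc.slice_derivs (b := ξ + 1) (hFC.mono Ioo_subset_Ioi_self) ⟨hξ, by linarith⟩

/-- `∂_r w = Λσρ F′(rρ)` at `r > 0`. -/
theorem hasDerivAt_ansatz_r {F : ℝ → ℝ} (hFC : ContDiffOn ℝ 2 F (Ioi 0)) (m S Λ s : ℝ) {r : ℝ} (hr : 0 < r) :
    HasDerivAt (fun r' => Λ * exp (m * log (S - s)) * F (r' * rho S s))
      (Λ * exp (m * log (S - s)) * rho S s * deriv F (r * rho S s)) r := by
  have hρ := rho_pos S s
  have h1 : HasDerivAt (fun r' => r' * rho S s) (1 * rho S s) r := (hasDerivAt_id' r).mul_const _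
  have h2 := ((profile_derivs hFC (mul_pos hr hρ)).1).comp r h1
  have h3 := h2.const_mul (Λ * exp (m * log (S - s)))
  exact h3.congr_deriv (by ring)

/-- `∂_r(Λσρ F′(rρ)) = Λσρ² F″(rρ)` at `r > 0`. -/
theorem hasDerivAt_dansatz_r {F : ℝ → ℝ} (hFC : ContDiffOn ℝ 2 F (Ioi 0)) (m S Λ s : ℝ) {r : ℝ} (hr : 0 < r) :
    HasDerivAt (fun r' => Λ * exp (m * log (S - s)) * rho S s * deriv F (r' * rho S s))
      (Λ * exp (m * log (S - s)) * rho S s ^ 2 * iteratedDeriv 2 F (r * rho S s)) r := by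
  have hρ := rho_pos S s
  have h1 : HasDerivAt (fun r' => r' * rho S s) (1 * rho S s) r := (hasDerivAt_id' r).mul_const _
  have h2 := ((profile_derivs hFC (mul_pos hr hρ)).2).comp r h1
  have h3 := h2.const_mul (Λ * exp (m * log (S - s)) * rho S s)
  exact h3.congr_deriv (by ring)

/-- `deriv_r w` at `r > 0`. -/
theorem deriv_ansatz_r {F : ℝ → ℝ} (hFC : ContDiffOn ℝ 2 F (Ioi 0)) (m S Λ s : ℝ) {r : ℝ} (hr : 0 < r) :
    deriv (fun r' => Λ * exp (m * log (S - s)) * F (r' * rho S s)) r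
      = Λ * exp (m * log (S - s)) * rho S s * deriv F (r * rho S s) :=
  (hasDerivAt_ansatz_r hFC m S Λ s hr).deriv

/-- `iteratedDeriv 2` in `r` at `r > 0`. -/
theorem iteratedDeriv_two_ansatz_r {F : ℝ → ℝ} (hFC : ContDiffOn ℝ 2 F (Ioi 0)) (m S Λ s : ℝ) {r : ℝ}
    (hr : 0 < r) :
    iteratedDeriv 2 (fun r' => Λ * exp (m * log (S - s)) * F (r' * rho S s)) r
      = Λ * exp (m * log (S - s)) * rho S s ^ 2 * iteratedDeriv 2 F (r * rho S s) := by
  rw [show (2 : ℕ) = 1 + 1 from rfl, iteratedDeriv_succ, iteratedDeriv_one]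
  have hev : deriv (fun r' => Λ * exp (m * log (S - s)) * F (r' * rho S s))
      =ᶠ[𝓝 r] fun r' => Λ * exp (m * log (S - s)) * rho S s * deriv F (r' * rho S s) := by
    filter_upwards [Ioi_mem_nhds hr] with r' hr' using deriv_ansatz_r hFC m S Λ s hr'
  rw [hev.deriv_eq]
  exact (hasDerivAt_dansatz_r hFC m S Λ s hr).deriv

/-- `∂_s w = Λσρ²((ξ/2)F′(ξ) − m F(ξ))`, `ξ = rρ`, at `r > 0`, `s < S`. -/
theorem hasDerivAt_ansatz_s {F : ℝ → ℝ} (hFC : ContDiffOn ℝ 2 F (Ioi 0)) (m S Λ : ℝ) {r s : ℝ}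
    (hr : 0 < r) (hs : 0 < S - s) :
    HasDerivAt (fun s' => Λ * exp (m * log (S - s')) * F (r * rho S s'))
      (Λ * exp (m * log (S - s)) * rho S s ^ 2 *
        (r * rho S s / 2 * deriv F (r * rho S s) - m * F (r * rho S s))) s := by
  have hL : HasDerivAt (fun s' => log (S - s')) ((0 - 1) / (S - s)) s :=
    ((hasDerivAt_const s S).sub (hasDerivAt_id' s)).log hs.ne'
  have hσ : HasDerivAt (fun s' => exp (m * log (S - s')))
      (exp (m * log (S - s)) * (m * ((0 - 1) / (S - s)))) s := (hL.const_mul _).exp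
  have hρ' : HasDerivAt (fun s' => exp (-(log (S - s') / 2)))
      (exp (-(log (S - s) / 2)) * (-((0 - 1) / (S - s) / 2))) s := (hL.div_const 2).neg.exp
  have hξ : 0 < r * exp (-(log (S - s) / 2)) := by positivity
  have hP : HasDerivAt (fun s' => F (r * exp (-(log (S - s') / 2))))
      (deriv F (r * exp (-(log (S - s) / 2))) * (r * (exp (-(log (S - s) / 2)) * (-((0 - 1) / (S - s) / 2))))) s :=
    ((profile_derivs hFC hξ).1).comp s (hρ'.const_mul r)
  have hw : HasDerivAt (fun s' => Λ * exp (m * log (S - s')) * F (r * exp (-(log (S - s') / 2))))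
      (Λ * (exp (m * log (S - s)) * (m * ((0 - 1) / (S - s)))) * F (r * exp (-(log (S - s) / 2)))
        + Λ * exp (m * log (S - s))
          * (deriv F (r * exp (-(log (S - s) / 2))) * (r * (exp (-(log (S - s) / 2)) * (-((0 - 1) / (S - s) / 2)))))) s :=
    (hσ.const_mul Λ).mul hP
  have e : (fun s' => Λ * exp (m * log (S - s')) * F (r * rho S s'))
      = fun s' => Λ * exp (m * log (S - s')) * F (r * exp (-(log (S - s') / 2))) := by
    funext s'; rfl
  rw [e]
  refine hw.congr_deriv ?_
  have h2 := rho_sq (T := S) hs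
  unfold rho at h2
  unfold rho
  linear_combination (-(Λ * exp (m * log (S - s))
    * (r * exp (-(log (S - s) / 2)) / 2 * deriv F (r * exp (-(log (S - s) / 2)))
        - m * F (r * exp (-(log (S - s) / 2)))))) * h2

/-- **The barrier inequality from the profile inequality.** If `F″ + (D(ξ)/ξ − 1/ξ − ξ/2)F′ + mF ≤ 0` at
`ξ = rρ(s)`, then `w_rr − w_r/r + (D(rρ)/r) w_r ≤ w_s` at `(r,s)` (`r > 0`, `s < S`, `Λ > 0`). [folklore] -/
theorem ansatz_pde {F D : ℝ → ℝ} (hFC : ContDiffOn ℝ 2 F (Ioi 0)) {m S Λ r s : ℝ} (hΛ : 0 < Λ) (hr : 0 < r)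
    (hs : s < S)
    (hODE : iteratedDeriv 2 F (r * rho S s) + (D (r * rho S s) / (r * rho S s) - (r * rho S s)⁻¹
        - r * rho S s / 2) * deriv F (r * rho S s) + m * F (r * rho S s) ≤ 0) :
    iteratedDeriv 2 (fun r' => Λ * exp (m * log (S - s)) * F (r' * rho S s)) r
        - r⁻¹ * deriv (fun r' => Λ * exp (m * log (S - s)) * F (r' * rho S s)) r
        + D (r * rho S s) / r * deriv (fun r' => Λ * exp (m * log (S - s)) * F (r' * rho S s)) r
      ≤ deriv (fun s' => Λ * exp (m * log (S - s')) * F (r * rho S s')) s := by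
  have hs' : 0 < S - s := by linarith
  rw [iteratedDeriv_two_ansatz_r hFC m S Λ s hr, deriv_ansatz_r hFC m S Λ s hr,
    (hasDerivAt_ansatz_s hFC m S Λ hr hs').deriv]
  set ρ := rho S s with hρdef
  set σ := exp (m * log (S - s)) with hσdef
  have hρ : 0 < ρ := rho_pos S s
  have hσ : 0 < σ := exp_pos _
  have hξ : 0 < r * ρ := mul_pos hr hρ
  have hK : 0 < Λ * σ * ρ ^ 2 := by positivity
  rw [← sub_nonneg]
  have e : Λ * σ * ρ ^ 2 * (r * ρ / 2 * deriv F (r * ρ) - m * F (r * ρ))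
      - (Λ * σ * ρ ^ 2 * iteratedDeriv 2 F (r * ρ) - r⁻¹ * (Λ * σ * ρ * deriv F (r * ρ))
        + D (r * ρ) / r * (Λ * σ * ρ * deriv F (r * ρ)))
      = -(Λ * σ * ρ ^ 2) * (iteratedDeriv 2 F (r * ρ)
          + (D (r * ρ) / (r * ρ) - (r * ρ)⁻¹ - r * ρ / 2) * deriv F (r * ρ) + m * F (r * ρ)) := by
    field_simp
    ring
  rw [e]
  exact mul_nonneg_of_nonpos_of_nonpos (by linarith) hODE

/-- Joint smoothness of the ansatz on `(0,∞) × (−∞,S)`. -/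
theorem contDiffOn_ansatz {F : ℝ → ℝ} (hFC : ContDiffOn ℝ 2 F (Ioi 0)) (m S Λ : ℝ) :
    ContDiffOn ℝ 2 (fun q : ℝ × ℝ => Λ * exp (m * log (S - q.2)) * F (q.1 * rho S q.2)) (Ioi 0 ×ˢ Iio S) := by
  have hsub : ∀ q ∈ (Ioi 0 ×ˢ Iio S : Set (ℝ × ℝ)), S - q.2 ≠ 0 := by
    intro q hq
    have : q.2 < S := (mem_prod.1 hq).2
    linarith
  have h1 : ContDiffOn ℝ 2 (fun q : ℝ × ℝ => S - q.2) (Ioi 0 ×ˢ Iio S) := by fun_prop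
  have hlog : ContDiffOn ℝ 2 (fun q : ℝ × ℝ => log (S - q.2)) (Ioi 0 ×ˢ Iio S) := h1.log hsub
  have hsig : ContDiffOn ℝ 2 (fun q : ℝ × ℝ => exp (m * log (S - q.2))) (Ioi 0 ×ˢ Iio S) :=
    (contDiffOn_const.mul hlog).exp
  have hrho : ContDiffOn ℝ 2 (fun q : ℝ × ℝ => exp (-(log (S - q.2) / 2))) (Ioi 0 ×ˢ Iio S) :=
    (hlog.div_const 2).neg.exp
  have harg : ContDiffOn ℝ 2 (fun q : ℝ × ℝ => q.1 * exp (-(log (S - q.2) / 2))) (Ioi 0 ×ˢ Iio S) :=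
    contDiffOn_fst.mul hrho
  have hmaps : MapsTo (fun q : ℝ × ℝ => q.1 * exp (-(log (S - q.2) / 2))) (Ioi 0 ×ˢ Iio S) (Ioi 0) := by
    intro q hq
    have : 0 < q.1 := (mem_prod.1 hq).1
    exact mul_pos this (exp_pos _)
  have hprof : ContDiffOn ℝ 2 (fun q : ℝ × ℝ => F (q.1 * exp (-(log (S - q.2) / 2)))) (Ioi 0 ×ˢ Iio S) :=
    hFC.comp harg hmaps
  exact (contDiffOn_const (c := Λ)).mul hsig |>.mul hprof

/-- Joint continuity of the ansatz on `[0,∞) × (−∞,S)`. -/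
theorem continuousOn_ansatz {F : ℝ → ℝ} (hFc : ContinuousOn F (Ici 0)) (m S Λ : ℝ) :
    ContinuousOn (fun q : ℝ × ℝ => Λ * exp (m * log (S - q.2)) * F (q.1 * rho S q.2)) (Ici 0 ×ˢ Iio S) := by
  have hsub : ∀ q ∈ (Ici 0 ×ˢ Iio S : Set (ℝ × ℝ)), S - q.2 ≠ 0 := by
    intro q hq
    have : q.2 < S := (mem_prod.1 hq).2
    linarith
  have h1 : ContinuousOn (fun q : ℝ × ℝ => S - q.2) (Ici 0 ×ˢ Iio S) := by fun_prop
  have hlog : ContinuousOn (fun q : ℝ × ℝ => log (S - q.2)) (Ici 0 ×ˢ Iio S) := h1.log hsub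
  have hsig : ContinuousOn (fun q : ℝ × ℝ => Λ * exp (m * log (S - q.2))) (Ici 0 ×ˢ Iio S) :=
    continuousOn_const.mul (continuousOn_const.mul hlog).rexp
  have hrho : ContinuousOn (fun q : ℝ × ℝ => exp (-(log (S - q.2) / 2))) (Ici 0 ×ˢ Iio S) :=
    (hlog.div_const 2).neg.rexp
  have harg : ContinuousOn (fun q : ℝ × ℝ => q.1 * exp (-(log (S - q.2) / 2))) (Ici 0 ×ˢ Iio S) :=
    continuousOn_fst.mul hrho
  have hmaps : MapsTo (fun q : ℝ × ℝ => q.1 * exp (-(log (S - q.2) / 2))) (Ici 0 ×ˢ Iio S) (Ici 0) := by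
    intro q hq
    have : 0 ≤ q.1 := (mem_prod.1 hq).1
    exact mul_nonneg this (exp_pos _).le
  have hprof := hFc.comp harg hmaps
  exact hsig.mul hprof

/-! ## §2 The reduction -/

/-- **Self-similar reduction: profile ODE supersolution ⇒ time-dependent half-line barrier, any Reynolds-number
profile `D`.**  Hypotheses on the profile `F` (with `0 < m`, `2m ≤ 1`, horizon `S > 0`, `ρ₀ = ρ(0) = S^{−1/2}`):
`C²` on `(0,∞)`, continuous and monotone on `[0,∞)`, `F(0) = 0`; `F ≤ C₀ξ^{2m}` on `[0,∞)`; `k₁ξ^{2m} ≤ F` for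
`ξ ≥ ρ₀`; `k₂ξ² ≤ F` on `[0, 2ρ₀]`; and the profile inequality `F″ + (D(ξ)/ξ − 1/ξ − ξ/2)F′ + mF ≤ 0` on `(0,∞)`.
Conclusion: the clause list `hB` of `RadialInflowComparisonT.hasSmoothExtensionPast_of_timeDependentBarrier_visc` /
`…_of_kappaEnvelope` on `(0,2) × (0,S)` for the drift coefficient `D(rρ(s))/r`, with `α = 2m`, witnessed by
`w(r,s) = Λ e^{m log(S−s)} F(rρ(s))`, `Λ = 1/k₁ + S/(e^{m log S} k₂)`.  (The κ-chain's `exists_halfLineBarrierW` is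
the instance `D = Mξ^κ`, `F = profW κ M`: `exists_halfLineBarrier_selfSimilar_kappa`.) [folklore; cite:
Zhang2026PartialTypeI §3 for κ = 1] -/
theorem exists_halfLineBarrier_selfSimilar {S m C₀ k₁ k₂ : ℝ} {D F : ℝ → ℝ} (hS : 0 < S) (hm : 0 < m)
    (h2m : 2 * m ≤ 1) (hC₀ : 0 < C₀) (hk₁ : 0 < k₁) (hk₂ : 0 < k₂)
    (hFC : ContDiffOn ℝ 2 F (Ioi 0)) (hFc : ContinuousOn F (Ici 0)) (hF0 : F 0 = 0)
    (hFmono : MonotoneOn F (Ici 0))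
    (hFle : ∀ ξ : ℝ, 0 ≤ ξ → F ξ ≤ C₀ * ξ ^ (2 * m))
    (hFfar : ∀ ξ : ℝ, rho S 0 ≤ ξ → k₁ * ξ ^ (2 * m) ≤ F ξ)
    (hFnear : ∀ ξ : ℝ, 0 ≤ ξ → ξ ≤ 2 * rho S 0 → k₂ * ξ ^ 2 ≤ F ξ)
    (hODE : ∀ ξ : ℝ, 0 < ξ → iteratedDeriv 2 F ξ + (D ξ / ξ - ξ⁻¹ - ξ / 2) * deriv F ξ + m * F ξ ≤ 0) :
    ∃ (α C : ℝ) (w : ℝ → ℝ → ℝ), 0 < α ∧ α ≤ 1 ∧ 0 < C ∧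
      ContDiffOn ℝ 2 (fun q : ℝ × ℝ => w q.1 q.2) (Ioo 0 2 ×ˢ Ioo 0 S) ∧
      ContinuousOn (fun q : ℝ × ℝ => w q.1 q.2) (Icc 0 2 ×ˢ Ico 0 S) ∧
      (∀ s ∈ Ico 0 S, w 0 s = 0 ∧ MonotoneOn (fun r => w r s) (Icc 0 2) ∧
        (∀ r ∈ Icc (0 : ℝ) 1, w r s ≤ C * r ^ α) ∧ 1 ≤ w 1 s) ∧
      (∀ r ∈ Icc (0 : ℝ) 2, min r 1 ^ 2 ≤ w r 0) ∧
      (∀ r ∈ Ioo (0 : ℝ) 2, ∀ s ∈ Ioo 0 S,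
        iteratedDeriv 2 (fun ρ => w ρ s) r - r⁻¹ * deriv (fun ρ => w ρ s) r
            + D (r * rho S s) / r * deriv (fun ρ => w ρ s) r
          ≤ deriv (fun s' => w r s') s) := by
  set ρ₀ := rho S 0 with hρ₀_def
  have hρ₀ : 0 < ρ₀ := rho_pos S 0
  set σ₀ := exp (m * log S) with hσ₀_def
  have hσ₀ : 0 < σ₀ := exp_pos _
  have hσ₀' : exp (m * log (S - 0)) = σ₀ := by rw [sub_zero]
  obtain ⟨Λ, hΛ_def⟩ : ∃ Λ : ℝ, Λ = 1 / k₁ + S / (σ₀ * k₂) := ⟨_, rfl⟩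
  have hΛ : 0 < Λ := by rw [hΛ_def]; positivity
  have hΛ1 : 1 / k₁ ≤ Λ := by
    rw [hΛ_def]; exact le_add_of_nonneg_right (by positivity)
  have hΛ2 : S / (σ₀ * k₂) ≤ Λ := by
    rw [hΛ_def]; exact le_add_of_nonneg_left (by positivity)
  refine ⟨2 * m, Λ * C₀, fun r s => Λ * exp (m * log (S - s)) * F (r * rho S s), by positivity, h2m,
    mul_pos hΛ hC₀, ?_, ?_, ?_, ?_, ?_⟩
  · exact (contDiffOn_ansatz hFC m S Λ).mono (prod_mono Ioo_subset_Ioi_self Ioo_subset_Iio_self)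
  · exact (continuousOn_ansatz hFc m S Λ).mono (prod_mono Icc_subset_Ici_self Ico_subset_Iio_self)
  · intro s hs
    have hs' : 0 < S - s := by linarith [hs.2]
    have hρ : 0 < rho S s := rho_pos S s
    have hσ : 0 < exp (m * log (S - s)) := exp_pos _
    refine ⟨?_, ?_, ?_, ?_⟩
    · simp [hF0]
    · intro r₁ hr₁ r₂ hr₂ h12
      have h0₁ : (0:ℝ) ≤ r₁ * rho S s := by have := hr₁.1; positivity
      have h0₂ : (0:ℝ) ≤ r₂ * rho S s := by have := hr₂.1; positivity
      show Λ * exp (m * log (S - s)) * F (r₁ * rho S s) ≤ Λ * exp (m * log (S - s)) * F (r₂ * rho S s)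
      apply mul_le_mul_of_nonneg_left _ (by positivity)
      exact hFmono h0₁ h0₂ (mul_le_mul_of_nonneg_right h12 hρ.le)
    · intro r hr
      show Λ * exp (m * log (S - s)) * F (r * rho S s) ≤ Λ * C₀ * r ^ (2 * m)
      have hξ0 : 0 ≤ r * rho S s := by have := hr.1; positivity
      have hb := hFle _ hξ0
      have hsplit : (r * rho S s) ^ (2 * m) = r ^ (2 * m) * rho S s ^ (2 * m) := mul_rpow hr.1 hρ.le
      have h1 := sig_mul_rho_rpow m S s
      calc Λ * exp (m * log (S - s)) * F (r * rho S s)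
          ≤ Λ * exp (m * log (S - s)) * (C₀ * (r * rho S s) ^ (2 * m)) := by gcongr
        _ = Λ * C₀ * r ^ (2 * m) * (exp (m * log (S - s)) * rho S s ^ (2 * m)) := by rw [hsplit]; ring
        _ = Λ * C₀ * r ^ (2 * m) := by rw [h1, mul_one]
    · show 1 ≤ Λ * exp (m * log (S - s)) * F (1 * rho S s)
      rw [one_mul]
      have hρρ : ρ₀ ≤ rho S s := by
        rw [hρ₀_def]; unfold rho
        apply exp_le_exp.2
        have : log (S - s) ≤ log (S - 0) := log_le_log hs' (by linarith [hs.1])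
        linarith
      have hb := hFfar _ hρρ
      have h1 := sig_mul_rho_rpow m S s
      calc (1 : ℝ) ≤ Λ * k₁ := by
              rw [← div_le_iff₀ hk₁]; exact hΛ1
        _ = Λ * (exp (m * log (S - s)) * (k₁ * rho S s ^ (2 * m))) := by
              rw [show exp (m * log (S - s)) * (k₁ * rho S s ^ (2 * m))
                  = k₁ * (exp (m * log (S - s)) * rho S s ^ (2 * m)) by ring, h1, mul_one]
        _ ≤ Λ * (exp (m * log (S - s)) * F (rho S s)) := by gcongr
        _ = Λ * exp (m * log (S - s)) * F (rho S s) := by ring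
  · intro r hr
    show min r 1 ^ 2 ≤ Λ * exp (m * log (S - 0)) * F (r * rho S 0)
    rw [hσ₀', ← hρ₀_def]
    have hξ0 : 0 ≤ r * ρ₀ := by have := hr.1; positivity
    have hξ2 : r * ρ₀ ≤ 2 * ρ₀ := by have := hr.2; nlinarith
    have hb := hFnear _ hξ0 hξ2
    have hρsq : ρ₀ ^ 2 = S⁻¹ := by rw [hρ₀_def, rho_sq (by linarith : 0 < S - 0)]; simp
    have hmin : min r 1 ^ 2 ≤ r ^ 2 := by
      have h0 : 0 ≤ min r 1 := le_min hr.1 zero_le_one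
      exact pow_le_pow_left₀ h0 (min_le_left r 1) 2
    have hmain : r ^ 2 ≤ Λ * σ₀ * F (r * ρ₀) := by
      calc r ^ 2 = (S / (σ₀ * k₂)) * σ₀ * (k₂ * (r ^ 2 * S⁻¹)) := by
              field_simp
            _ ≤ Λ * σ₀ * (k₂ * (r ^ 2 * S⁻¹)) := by gcongr
            _ = Λ * σ₀ * (k₂ * (r * ρ₀) ^ 2) := by rw [mul_pow, hρsq]
            _ ≤ Λ * σ₀ * F (r * ρ₀) := by gcongr
    exact hmin.trans hmain
  · intro r hr s hs
    exact ansatz_pde (D := D) hFC hΛ hr.1 hs.2 (hODE _ (mul_pos hr.1 (rho_pos S s)))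

/-! ## §3 End to end: a Reynolds-number profile with an ODE profile gives a one-sided criterion -/

/-- **One-sided criterion from a profile pair `(D, F)`, every viscosity.** If `(D, F, m)` satisfy the hypotheses
of `exists_halfLineBarrier_selfSimilar` with horizon `S = νT`, then every axisymmetric classical Leray–Hopf solution
of the standing class on `[0,T)` at viscosity `ν` whose inflow Reynolds number obeys
`−r u_r ≤ ν D(r/√(ν(T−t)))` on the unit tube — i.e. `u_r ≥ −ν D(r/√(ν(T−t)))/r` — extends smoothly past `T`.
Proof: `RadialInflowComparisonT.hasSmoothExtensionPast_of_timeDependentBarrier_visc` with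
`E(r,t) = ν D(r/√(ν(T−t)))/r`, whose dilated coefficient `ν⁻¹E(r, ν⁻¹s)` is `D(rρ_{νT}(s))/r`, the barrier
of §2, and the sub-slab bound `RadialInflowComparisonT.exists_bound_subslab`. [folklore] -/
theorem hasSmoothExtensionPast_of_reynoldsProfile {ν T m C₀ k₁ k₂ : ℝ} {D F : ℝ → ℝ}
    {u : ℝ → EuclideanSpace ℝ (Fin 3) → EuclideanSpace ℝ (Fin 3)} {p : ℝ → EuclideanSpace ℝ (Fin 3) → ℝ}
    (hν : 0 < ν) (hT : 0 < T) (hm : 0 < m) (h2m : 2 * m ≤ 1) (hC₀ : 0 < C₀) (hk₁ : 0 < k₁) (hk₂ : 0 < k₂)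
    (hFC : ContDiffOn ℝ 2 F (Ioi 0)) (hFc : ContinuousOn F (Ici 0)) (hF0 : F 0 = 0)
    (hFmono : MonotoneOn F (Ici 0))
    (hFle : ∀ ξ : ℝ, 0 ≤ ξ → F ξ ≤ C₀ * ξ ^ (2 * m))
    (hFfar : ∀ ξ : ℝ, rho (ν * T) 0 ≤ ξ → k₁ * ξ ^ (2 * m) ≤ F ξ)
    (hFnear : ∀ ξ : ℝ, 0 ≤ ξ → ξ ≤ 2 * rho (ν * T) 0 → k₂ * ξ ^ 2 ≤ F ξ)
    (hODE : ∀ ξ : ℝ, 0 < ξ → iteratedDeriv 2 F ξ + (D ξ / ξ - ξ⁻¹ - ξ / 2) * deriv F ξ + m * F ξ ≤ 0)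
    (hcl : IsClassicalNSSolutionOn (Ico 0 T) ν 0 u p) (hLH : IsLerayHopfOn T ν 0 (u 0) u)
    (hdec : HasRapidSpatialDecay (u 0)) (hax : ∀ t ∈ Ico 0 T, IsAxisymmetric (u t))
    (henv : ∀ t ∈ Ico 0 T, ∀ x : EuclideanSpace ℝ (Fin 3), 0 < cylRadius x → cylRadius x ≤ 1 →
      -(ν * D (cylRadius x / √(ν * (T - t))) / cylRadius x) ≤ radialVelocity (u t) x) :
    HasSmoothExtensionPast ν 0 u T := by
  obtain ⟨α, C, w, hα, -, -, hC2j, hC0j, hsl, hdat0, hpde⟩ :=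
    exists_halfLineBarrier_selfSimilar (D := D) (mul_pos hν hT) hm h2m hC₀ hk₁ hk₂ hFC hFc hF0 hFmono hFle hFfar
      hFnear hODE
  refine RadialInflowComparisonT.hasSmoothExtensionPast_of_timeDependentBarrier_visc
    (E := fun r t => ν * D (r / √(ν * (T - t))) / r) hν hT hα hC2j hC0j hsl hdat0 (fun r hr s hs => ?_) hcl hLH
    hdec (RadialInflowComparisonT.exists_bound_subslab hν hT hcl hLH hdec) hax henv
  -- the dilated coefficient `ν⁻¹ E(r, ν⁻¹ s) = D(r ρ_{νT}(s)) / r`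
  have hs' : 0 < ν * T - s := by linarith [hs.2]
  have e1 : ν * (T - ν⁻¹ * s) = ν * T - s := by field_simp
  have e2 : r / √(ν * (T - ν⁻¹ * s)) = r * rho (ν * T) s := by
    rw [e1, sqrt_eq_rho_inv hs', div_inv_eq_mul]
  have e3 : ν⁻¹ * (ν * D (r / √(ν * (T - ν⁻¹ * s))) / r) = D (r * rho (ν * T) s) / r := by
    rw [e2]; field_simp
  simp only [e3]
  exact hpde r hr s hs

/-! ## §4 Consistency: the κ-barrier is the instance `D = Mξ^κ`, `F = profW κ M` -/

/-- `deriv` and `iteratedDeriv 2` of the κ-profile. -/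
theorem deriv_profW {κ M ξ : ℝ} (hκ0 : 0 < κ) (hκ1 : κ ≤ 1) (hM : 0 < M) (hξ : 0 < ξ) :
    deriv (profW κ M) ξ = dprofW κ M ξ ∧ iteratedDeriv 2 (profW κ M) ξ = ddprofW κ M ξ := by
  refine ⟨(hasDerivAt_profW hκ0 hκ1 hM hξ).deriv, ?_⟩
  rw [show (2 : ℕ) = 1 + 1 from rfl, iteratedDeriv_succ, iteratedDeriv_one]
  have hev : deriv (profW κ M) =ᶠ[𝓝 ξ] dprofW κ M := by
    filter_upwards [Ioi_mem_nhds hξ] with x hx using (hasDerivAt_profW hκ0 hκ1 hM hx).deriv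
  rw [hev.deriv_eq]
  exact (hasDerivAt_dprofW hκ0 hκ1 hM hξ).deriv

/-- **Consistency with the κ-chain.** For `0 < κ ≤ 1`, `M, S > 0` the reduction applied to `D(ξ) = Mξ^κ`,
`F = profW κ M`, `m = expoW κ M` gives a half-line barrier for the drift coefficient `M(rρ)^κ/r`
(`= M r^{κ−1}(S−s)^{−κ/2}`, `ZhangBarrier.envelope_selfsimilar`) — the content of
`ZhangBarrier.exists_halfLineBarrierW`, recovered from the generic theorem. [new, bookkeeping] -/
theorem exists_halfLineBarrier_selfSimilar_kappa {κ M S : ℝ} (hκ0 : 0 < κ) (hκ1 : κ ≤ 1) (hM : 0 < M)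
    (hS : 0 < S) :
    ∃ (α C : ℝ) (w : ℝ → ℝ → ℝ), 0 < α ∧ α ≤ 1 ∧ 0 < C ∧
      ContDiffOn ℝ 2 (fun q : ℝ × ℝ => w q.1 q.2) (Ioo 0 2 ×ˢ Ioo 0 S) ∧
      ContinuousOn (fun q : ℝ × ℝ => w q.1 q.2) (Icc 0 2 ×ˢ Ico 0 S) ∧
      (∀ s ∈ Ico 0 S, w 0 s = 0 ∧ MonotoneOn (fun r => w r s) (Icc 0 2) ∧
        (∀ r ∈ Icc (0 : ℝ) 1, w r s ≤ C * r ^ α) ∧ 1 ≤ w 1 s) ∧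
      (∀ r ∈ Icc (0 : ℝ) 2, min r 1 ^ 2 ≤ w r 0) ∧
      (∀ r ∈ Ioo (0 : ℝ) 2, ∀ s ∈ Ioo 0 S,
        iteratedDeriv 2 (fun ρ => w ρ s) r - r⁻¹ * deriv (fun ρ => w ρ s) r
            + (M * (r * rho S s) ^ κ) / r * deriv (fun ρ => w ρ s) r
          ≤ deriv (fun s' => w r s') s) := by
  have hρ₀ : 0 < rho S 0 := rho_pos S 0
  refine exists_halfLineBarrier_selfSimilar (D := fun ξ => M * ξ ^ κ) (F := profW κ M) (m := expoW κ M) hS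
    (expoW_pos hκ0 hM) ((two_expoW_le hκ0 hM).trans hκ1) (C0W_pos hκ0 hM) (kappa1W_pos hκ0 hM hρ₀)
    (kappa2W_pos (ξ₂ := 2 * rho S 0) hκ0 hM) (contDiffOn_profW κ M) (continuous_profW hκ0 hκ1).continuousOn
    (profW_zero hκ0) (monotoneOn_profW hκ0 hκ1 hM) (fun ξ hξ => profW_le hκ0 hκ1 hM hξ)
    (fun ξ hξ => profW_ge_rpow hκ0 hκ1 hM hρ₀ hξ)
    (fun ξ h0 h2 => profW_ge_sq hκ0 hκ1 hM (by positivity) h0 h2) fun ξ hξ => ?_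
  obtain ⟨h1, h2⟩ := deriv_profW hκ0 hκ1 hM hξ
  rw [h1, h2]
  have e : M * ξ ^ κ / ξ = M * ξ ^ (κ - 1) := by
    rw [rpow_sub_one hξ.ne', mul_div_assoc]
  rw [e]
  exact profileW_ineq hκ0 hκ1 hM hξ

end Summit.NavierStokesRegularity.NavierStokesRegularity.Theorems.RadialInflowSelfSimilar

end
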